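import Summits.Langlands.Langlands.Theses.SqrtFiveQuarticCovers
import Literature.NumberTheory.Automorphic.TotallyRealNonModularImages
import Literature.NumberTheory.Automorphic.ThorneQInfinityModularTheorem2Proofs
import HarnessLib

/-!
# Route `SqrtFiveQuarticCovers` — crux `BoxQuartic` (stmt-Langlands-17836), line `birth`:
# stub `stub_fiveBorel` (Box 2022, Thm. 1.3 (ii) = Thorne 2016, Thm. 7.6)

The registered stub `stub_fiveBorel` of the skeleton
`Summits/Langlands/Langlands/Cruxes/BoxQuartic/Lines/birth.lean` says: for `K` totally real (any
degree) with `√5 ∉ K` (`¬ ∃ r : K, r ^ 2 = 5`) and an integral model `E / 𝓞 K` with `Δ(E) ≠ 0`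
that is NOT modular in the trace-only sense of the summit's cone
(`Literature.NumberTheory.Automorphic.IsModularEllipticCurve K E`, written out), some framing of
`E[5]` (`WeierstrassCurve.IsTorsionGaloisRep`, written out) has image in the Borel `B(5)` (entry
`(1,0)` zero).  This is J. Box, Trans. AMS 375 (2022), Thm. 1.3 (ii) — "Part (ii) was shown by
Thorne" — i.e. J. Thorne, Math. Ann. 364 (2016), Thm. 7.6: `√5 ∉ F`, no `F`-rational `5`-isogeny
⇒ modular.  It is the only joint of the line where `√5 ∉ K` enters.

HONEST STATUS — CONDITIONAL.  Thorne's theorem is Taylor–Wiles–Kisin patching; the tree holds its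
inputs as NAMED FACTS (D-0014).  Two renderings of the stub are landed, each taking its facts as
explicit hypotheses:

* `stub_fiveBorel_of_liftingTheorems` — from the TWO PRINTED LIFTING THEOREMS that Thorne's proof
  of Thm. 7.6 cites: `FLS2015_theorem3` (Freitas–Le Hung–Siksek 2015, Thm. 3, the case
  "`ρ̄_{E,5}(G_{F(ζ₅)})` absolutely irreducible") and hypothesis (T) = Thorne 2016, Thm. 7.5
  (= Thm. 1.2) for `ρ_{E,p}` (the residually dihedral case), WRITTEN OUT character for character as
  the binder `hT` of the tree's `Thorne2016_theorem7_6_of_dihedralLifting` /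
  `Box2022_theorem1_3_of_liftingTheorems` (it is verbatim the body of the named fact
  `Literature.NumberTheory.Automorphic.Thorne2016_theorem7_5_ellipticCurve` of
  `ResiduallyDihedralAutomorphyLifting.lean`, whose module has no hub build yet and so cannot be
  imported here), through the tree's PROVED reductions `Thorne2016_theorem7_6_of_dihedralLifting`
  and `Box2022_theorem1_3_five_of_theorem7_6` (file `ThorneQInfinityModularTheorem2Proofs.lean`).
  Finest trust base the tree offers.
* `stub_fiveBorel_of_Box2022_theorem1_3` — from the single named fact `Box2022_theorem1_3` (ii),
  through `Box2022_theorem1_3.borel_five` (file `TotallyRealNonModularImages.lean`), as the line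
  card `Lines/birth.md` planned.

`¬ ∃ r, r ^ 2 = 5` becomes `¬ IsSquare (5 : K)` in one line (`IsSquare 5 ↔ ∃ r, 5 = r * r`); the written-out cone
clauses close against `IsModularEllipticCurve` / `IsTorsionGaloisRep` by `δ`.  Nothing here proves
a lifting theorem.

References: [Box2022] arXiv:2103.13975, Thm. 1.3 (ii) (p. 4); [Thorne2016] Math. Ann. 364 (2016)
= arXiv:1504.00994, Thms. 7.5–7.6 (pp. 36–37); [FreitasLeHungSiksek2015] Invent. Math. 201
(2015), Thm. 3.
-/

noncomputable section

set_option linter.dupNamespace false -- project-wide option; `Summit.Langlands.Langlands` is the mandated namespace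

open scoped MatrixGroups NumberField Matrix
open NumberField
open Literature.NumberTheory.Automorphic Literature.NumberTheory.GaloisRepresentations
open Summit.Langlands.Langlands.Theses.SqrtFiveQuarticCovers

namespace Summit.Langlands.Langlands.Theorems

/-- **Stub `stub_fiveBorel` from the two printed lifting theorems** `FLS2015_theorem3` (named
fact) and (T) = Thorne 2016, Thm. 7.5 for `ρ_{E,p}` (hypothesis `hT`, written out verbatim as in
`Thorne2016_theorem7_6_of_dihedralLifting`; = the named fact `Thorne2016_theorem7_5_ellipticCurve`)
— both taken as hypotheses, CONDITIONAL.  For `K`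
totally real with `√5 ∉ K` and `E / 𝓞 K` (`Δ ≠ 0`) not modular in the trace-only sense, some
framing of `E[5]` is upper triangular.  Proof: weak non-modularity gives
`¬ IsAutomorphicOfWeightZero E` (`not_isAutomorphicOfWeightZero_of_not_isModularEllipticCurve`);
Thorne's Thm. 7.6 in the form `Thorne2016_theorem7_6_of_dihedralLifting h3 hT` says a curve with
irreducible `E[5]` over such a `K` IS automorphic, so `E[5]` is reducible and a framing is Borel
(`Box2022_theorem1_3_five_of_theorem7_6`).  The statement is the registered stub signature
verbatim. [cite: Box2022, Thm. 1.3 (ii)] [cite: Thorne2016, Thms. 7.5, 7.6]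
[cite: FreitasLeHungSiksek2015, Thm. 3] -/
theorem stub_fiveBorel_of_liftingTheorems (h3 : FLS2015_theorem3)
    (hT : ∀ (F : Type) [Field F] [NumberField F] [IsTotallyReal F] (p : ℕ) [Fact p.Prime], p ≠ 2 →
      ∀ (E : WeierstrassCurve (𝓞 F)), E.Δ ≠ 0 →
        ∀ ρ : ModPGaloisRep F (ZMod p) 2, (E.baseChange F).IsTorsionGaloisRep p ρ →
          FramedRep.IsAbsolutelyIrreducible ρ →
          ∀ (L : Type) [Field L] [Algebra F L] [IsCyclotomicExtension {p} F L],
            (∃ (k : Type) (_ : Field k) (f : ZMod p →+* k) (Q : GL (Fin 2) k),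
                (∀ τ : Field.absoluteGaloisGroup L,
                  Q * Matrix.GeneralLinearGroup.map f (FramedGaloisRep.restrictField L ρ τ) * Q⁻¹ ∈
                    Serre1972.diagonalSubgroup k) ∧
                ∃ τ : Field.absoluteGaloisGroup L,
                  ((Q * Matrix.GeneralLinearGroup.map f (FramedGaloisRep.restrictField L ρ τ) *
                      Q⁻¹ : GL (Fin 2) k) : Matrix (Fin 2) (Fin 2) k) 0 0 ≠
                    ((Q * Matrix.GeneralLinearGroup.map f (FramedGaloisRep.restrictField L ρ τ) *
                      Q⁻¹ : GL (Fin 2) k) : Matrix (Fin 2) (Fin 2) k) 1 1) →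
            (∃ (M : Type) (_ : Field M) (_ : Algebra F M),
                Module.finrank F M = 2 ∧ IsTotallyReal M ∧ Nonempty (M →ₐ[F] L)) →
            IsAutomorphicOfWeightZero E) :
    ∀ (K : Type) [Field K] [NumberField K], NumberField.IsTotallyReal K → (¬ ∃ r : K, r ^ 2 = 5) → ∀ E : WeierstrassCurve (NumberField.RingOfIntegers K), E.Δ ≠ 0 → ¬ ((E.baseChange K).HasCM ∨ ∃ (hF : Literature.NumberTheory.Automorphic.isCompact_glFiniteIntegralLevel 2 K) (π : Literature.NumberTheory.Automorphic.CuspidalAutomorphicRepData 2 K hF), π.1.HasWeightZero ∧ ∀ᶠ w : IsDedekindDomain.HeightOneSpectrum (NumberField.RingOfIntegers K) in Filter.cofinite, ∃ α : Multiset ℂ, π.1.HasSatakeParamAt w α ∧ ((Real.sqrt w.residueCard : ℝ) : ℂ) * α.sum = (Literature.NumberTheory.Automorphic.frobTraceAt E w : ℂ)) → (∃ ρ : Literature.NumberTheory.GaloisRepresentations.FramedGaloisRep K (ZMod 5) 2, (∃ e : (E.baseChange K).geomTorsion ((5 : ℕ) : ℤ) ≃+ (Fin 2 → ZMod 5), ∀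 (σ : Field.absoluteGaloisGroup K) (P : (E.baseChange K).geomTorsion ((5 : ℕ) : ℤ)), e (σ • P) = ((ρ σ : GL (Fin 2) (ZMod 5)) : Matrix (Fin 2) (Fin 2) (ZMod 5)) *ᵥ (e P)) ∧ (∀ σ : Field.absoluteGaloisGroup K, (((ρ σ : GL (Fin 2) (ZMod 5)) : Matrix (Fin 2) (Fin 2) (ZMod 5)) 1 0 = 0))) := by
  intro K _ _ hK h5 E hE hne
  haveI : IsTotallyReal K := hK
  have h5' : ¬ IsSquare (5 : K) := fun ⟨r, hr⟩ => h5 ⟨r, by rw [sq]; exact hr.symm⟩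
  have hne' : ¬ IsAutomorphicOfWeightZero E :=
    not_isAutomorphicOfWeightZero_of_not_isModularEllipticCurve hE hne
  exact Box2022_theorem1_3_five_of_theorem7_6
    (fun F _ _ _ h5F E' hΔ' hirr => Thorne2016_theorem7_6_of_dihedralLifting h3 hT F h5F E' hΔ' hirr)
    K E hE hne' h5'

/-- **Stub `stub_fiveBorel` from the named fact `Box2022_theorem1_3`** (clause (ii), taken as a
hypothesis — CONDITIONAL): the line card's planned consumption, through
`Box2022_theorem1_3.borel_five`; the written-out cone clauses close by `δ`.  The statement is the
registered stub signature verbatim. [cite: Box2022, Thm. 1.3 (ii)] -/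
theorem stub_fiveBorel_of_Box2022_theorem1_3 (h : Box2022_theorem1_3) :
    ∀ (K : Type) [Field K] [NumberField K], NumberField.IsTotallyReal K → (¬ ∃ r : K, r ^ 2 = 5) → ∀ E : WeierstrassCurve (NumberField.RingOfIntegers K), E.Δ ≠ 0 → ¬ ((E.baseChange K).HasCM ∨ ∃ (hF : Literature.NumberTheory.Automorphic.isCompact_glFiniteIntegralLevel 2 K) (π : Literature.NumberTheory.Automorphic.CuspidalAutomorphicRepData 2 K hF), π.1.HasWeightZero ∧ ∀ᶠ w : IsDedekindDomain.HeightOneSpectrum (NumberField.RingOfIntegers K) in Filter.cofinite, ∃ α : Multiset ℂ, π.1.HasSatakeParamAt w α ∧ ((Real.sqrt w.residueCard : ℝ) : ℂ) * α.sum = (Literature.NumberTheory.Automorphic.frobTraceAt E w : ℂ)) → (∃ ρ : Literature.NumberTheory.GaloisRepresentations.FramedGaloisRep K (ZMod 5) 2, (∃ e : (E.baseChange K).geomTorsion ((5 : ℕ) : ℤ) ≃+ (Fin 2 → ZMod 5), ∀ (σ : Field.absoluteGaloisGroup K) (P : (E.baseChange K).geomTorsion ((5 : ℕ) : ℤ)),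 e (σ • P) = ((ρ σ : GL (Fin 2) (ZMod 5)) : Matrix (Fin 2) (Fin 2) (ZMod 5)) *ᵥ (e P)) ∧ (∀ σ : Field.absoluteGaloisGroup K, (((ρ σ : GL (Fin 2) (ZMod 5)) : Matrix (Fin 2) (Fin 2) (ZMod 5)) 1 0 = 0))) := by
  intro K _ _ hK h5 E hE hne
  have h5' : ¬ IsSquare (5 : K) := fun ⟨r, hr⟩ => h5 ⟨r, by rw [sq]; exact hr.symm⟩
  exact Box2022_theorem1_3.borel_five h K hK h5' E hE hne

end Summit.Langlands.Langlands.Theorems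

end
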